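import Literature.MathematicalPhysics.QuantumFieldTheory.Balaban1983to89.MassGapFunctionalInequalities
import Literature.MathematicalPhysics.QuantumFieldTheory.LatticeGaugeDobrushinPoincare
import Literature.MathematicalPhysics.QuantumLattice.WilsonWeightConcentration
import HarnessLib

/-!
# Mass gap from functional inequalities, §11: the one-link Dobrushin no-go at weak coupling, unconditionally

Sibling of the IR-2 lineage module `MassGapFunctionalInequalities.lean` (§9b there: `ym_two_tests_le_rowsum`,
`ym_eventually_lt_rowsum`) — that module sits at the gate's size cap, so §11 lives here. NOT summit progress:
this file types and proves a NEGATIVE statement about one proof ENGINE (Dobrushin–Vasserstein uniqueness from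
one-link estimates, the engine of the tree's strong-coupling pipeline `shen_zhu_zhu_of_dobrushinCondition`,
Shen–Zhu–Zhu CMP 400 (2023) Assumption 1.1 / Rem. 1.3), and says nothing about the Jaffe–Witten mass gap itself.

## What §9b left conditional and what is discharged here

`ym_eventually_lt_rowsum` (lineage module §9b) concludes: along couplings `β_k`, EVENTUALLY every
Dobrushin–Vasserstein matrix `C` of the Wilson specification `ymSpecification ρ β_k` (any weight `r ≥ 0` with
`r(a,a) = 0`, any finite neighbourhood system) has row sum `> c` at a link `e` — PROVIDED (hypothesis `hconc`)
the gauge-displacement functional of two test functions under the one-link law `ν_β = γ^β_{e}(· | 1)` converges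
to a limit `ℓ > L·c·max(r(1,h), r(1,h⁻¹))`. The convergence was argued in prose (Laplace concentration of
`ν_β` at the identity; `ir/SUFFICIENT.md` §II.12) and flagged by the cell's referee as the one unproved step of
the weak-coupling no-go (GAPS G-ref2-26 (c)). This file PROVES it, from the tree's Laplace-concentration module
(`Literature.Probability.Distributions.LaplaceConcentration`, `…QuantumLattice.WilsonWeightConcentration`):

* `card_plaquettesTouching_singleton` — EXACTLY `2(d−1)` plaquettes contain a given link of `ℤ^d` (the tree had
  `≤`, `card_plaquettesTouching_singleton_le`).
* `staple_one`, `wilsonBoundaryAction_singleton_update_one` — in the unit background every staple is `1`, so the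
  one-link Wilson action is `S_{e}(1^{e ← g}) = 2(d−1)·(N − Re tr ρ(g))`.
* `siteLaw_ymSpecification_one_eq_gibbsTilt` — **the identification**: the one-link conditional law of the Wilson
  specification at the unit background is the Gibbs tilt of Haar measure by the Wilson energy
  `s_ρ(g) = 1 − N⁻¹ Re tr ρ(g)` at effective coupling `κ = 2(d−1)·N·β`:
  `γ^β_{e}(· | 1) = gibbsTilt Haar s_ρ (2(d−1)Nβ)`.
* `tendsto_integral_siteLaw_ymSpecification_one` (+ `_seq`) — for `d ≥ 2`, `N ≥ 1` and `ρ` continuous,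
  unitary and FAITHFUL: `∫ f dγ^β_{e}(· | 1) → f(1)` as `β → +∞` for every continuous `f : G → ℝ`.
* `ym_rowsum_eventually_gt` (+ `_seq`) — **the unconditional no-go**: for every weight `r ≥ 0` with
  `r(a,a) = 0`, every `h ∈ G` and continuous test functions `φ₁, φ₂` that are `L`-Lipschitz for `r` with
  `L·c·max(r(1,h), r(1,h⁻¹)) < (φ₁(1) − φ₁(h)) + (φ₂(1) − φ₂(h))`, EVENTUALLY IN `β` every KR-contraction
  matrix of `ymSpecification ρ β` for `r` (any neighbourhood system) has row sum `> c` at EVERY link `e`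
  (uniformly: the one-link law at the unit background is the same at all links); `ym_eventually_lt_rowsum_of_continuous`
  is the lineage statement at a fixed link with `hconc` discharged, its proof term being `ym_eventually_lt_rowsum`
  applied to the proved concentration.
* `ym_rowsum_eventually_gt_tv` — total-variation weight (`r(a,b) = 1_{a ≠ b}`), any `h ≠ 1`: EVERY `c < 2` is
  eventually exceeded (Urysohn bump equal to `1` at `1` and `0` at `h`); in particular Dobrushin's uniqueness
  condition (row sums `≤ c < 1`) fails at all large `β`.
* `ym_rowsum_eventually_gt_of_continuous` — continuous pseudo-metric weights (symmetric, triangle inequality):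
  every `c` with `c·max(r(1,h), r(1,h⁻¹)) < 2 r(1,h)` is eventually exceeded; for a left-invariant one
  (`ym_rowsum_eventually_gt_of_leftInvariant`; e.g. the bi-invariant Riemannian distance of [SZZ23]) every
  `c < 2`, as soon as some `h` has `r(1,h) > 0`.
* `sun_rowsum_eventually_gt_tv` — the tree's Shen–Zhu–Zhu setting (`SU(N)`, fundamental representation,
  't Hooft scaling `N β`): for the total-variation weight every `c < 2` is eventually exceeded, for EVERY finite
  neighbourhood system — so the hypothesis `hDob` of `shen_zhu_zhu_of_dobrushinCondition` (row sums `≤ c < 1`),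
  available for `|β| < 1/(16(d−1))`, has no large-`β` analogue for this weight BY THEOREM.

## Erratum to the lineage docstrings (recorded, not silently fixed)

The §9 / §9b docstrings of `MassGapFunctionalInequalities.lean` (v6.1) say the failure holds for "every
`d ≥ 1`". For `d = 1` there are NO plaquettes: the one-link law is Haar measure at every `β` and for every
boundary condition (`siteLaw_ymSpecification_eq_haar_of_d_eq_one`), and Dobrushin's condition holds trivially
with the ZERO matrix (`isKRContraction_ymSpecification_of_d_eq_one`). The correct range is `d ≥ 2`, carried as
the hypothesis `2 ≤ d` below; the effective coupling `2(d−1)Nβ` vanishes identically in `d = 1`.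

## Honest scope

(i) One-link (single-site) Dobrushin only: nothing is said about block (multi-link) versions of Dobrushin's
condition, nor about Dobrushin–Shlosman mixing, nor about any gauge-FIXED specification. (ii) The test functions
must be continuous (the §9b statement allows bounded measurable ones; lower semicontinuous metric weights are
treated in prose only, `ir/SUFFICIENT.md` §II.12 (M)). (iii) `ρ` must be faithful: for non-faithful `ρ` the
one-link law concentrates on `ker ρ`, not at `1`, and the displacement by `h ∈ ker ρ` is invisible. (iv) The
rate in `β` is not quantified here (the prose census `ir/SUFFICIENT.md` §II.12 has the Laplace asymptotics).
All statements are [folklore]-tagged kernel facts about the tree's own definitions; no printed theorem is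
invoked as a hypothesis.
-/

noncomputable section

open MeasureTheory Filter Topology
open scoped NNReal
open Literature.MathematicalPhysics.QuantumLattice Literature.MathematicalPhysics.QuantumFieldTheory
open Literature.Probability.Distributions Literature.Barriers.QuantumFields
open ProbabilityTheory Literature.Probability.LatticeModels Literature.Probability.LatticeModels.DobrushinMetric

namespace Literature.MathematicalPhysics.QuantumFieldTheory.Balaban1983to89.Sufficient

variable {d : ℕ}

/-! ### Exactly `2(d-1)` plaquettes through a link -/

section Count

/-- For every direction `j` other than that of the link `e` and every side `b` there is a plaquette through `e`
with other direction `j` on side `b` (based at `e.1` if `b`, at `e.1 − e_j` otherwise). [folklore] -/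
theorem exists_plaquette_through (e : ZdEdge d) {j : Fin d} (hj : j ≠ e.2) (b : Bool) :
    ∃ p ∈ plaquettesTouching {e}, plaqOtherDir e p = j ∧ plaqSide e p = b := by
  have hne0 : (Pi.single j (1 : ℤ) : Fin d → ℤ) ≠ 0 := pi_single_one_ne_zero j
  rcases lt_or_gt_of_ne hj with hlt | hgt
  · -- `j < e.2`: the plane is `(j, e.2)`
    cases b
    · refine ⟨(e.1 - Pi.single j 1, ⟨(j, e.2), hlt⟩), ?_, ?_, ?_⟩
      · rw [mem_plaquettesTouching_singleton]
        unfold plaquetteEdges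
        simp only [Finset.mem_insert, Finset.mem_singleton]
        exact Or.inr (Or.inl (Prod.ext (by simp) rfl))
      · simp [plaqOtherDir, hj]
      · simp [plaqSide, sub_eq_self, hne0]
    · refine ⟨(e.1, ⟨(j, e.2), hlt⟩), ?_, ?_, ?_⟩
      · rw [mem_plaquettesTouching_singleton]
        unfold plaquetteEdges
        simp
      · simp [plaqOtherDir, hj]
      · simp [plaqSide]
  · -- `e.2 < j`: the plane is `(e.2, j)`
    cases b
    · refine ⟨(e.1 - Pi.single j 1, ⟨(e.2, j), hgt⟩), ?_, ?_, ?_⟩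
      · rw [mem_plaquettesTouching_singleton]
        unfold plaquetteEdges
        simp only [Finset.mem_insert, Finset.mem_singleton]
        exact Or.inr (Or.inr (Or.inl (Prod.ext (by simp) rfl)))
      · simp [plaqOtherDir]
      · simp [plaqSide, sub_eq_self, hne0]
    · refine ⟨(e.1, ⟨(e.2, j), hgt⟩), ?_, ?_, ?_⟩
      · rw [mem_plaquettesTouching_singleton]
        unfold plaquetteEdges
        simp
      · simp [plaqOtherDir]
      · simp [plaqSide]

/-- **Exactly `2(d-1)` plaquettes contain a given link of `ℤ^d`**: one for each other direction and each side
(the tree's `card_plaquettesTouching_singleton_le` is the upper bound; `exists_plaquette_through` gives the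
surjection for the lower bound). [folklore] -/
theorem card_plaquettesTouching_singleton (e : ZdEdge d) : (plaquettesTouching {e}).card = 2 * (d - 1) := by
  classical
  refine le_antisymm (card_plaquettesTouching_singleton_le e) ?_
  have hsurj : Set.SurjOn (fun p => (plaqOtherDir e p, plaqSide e p)) ↑(plaquettesTouching {e})
      ↑((Finset.univ.erase e.2) ×ˢ (Finset.univ : Finset Bool)) := by
    rintro ⟨j, b⟩ hjb
    have hj : j ≠ e.2 := (Finset.mem_erase.1 (Finset.mem_product.1 (Finset.mem_coe.1 hjb)).1).1
    obtain ⟨p, hp, h1, h2⟩ := exists_plaquette_through e hj b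
    exact ⟨p, Finset.mem_coe.2 hp, Prod.ext h1 h2⟩
  calc 2 * (d - 1) = ((Finset.univ.erase e.2) ×ˢ (Finset.univ : Finset Bool)).card := by
        rw [Finset.card_product, Finset.card_erase_of_mem (Finset.mem_univ _), Finset.card_univ,
          Fintype.card_fin, Finset.card_univ, Fintype.card_bool]
        ring
    _ ≤ (plaquettesTouching {e}).card := Finset.card_le_card_of_surjOn _ hsurj

/-- In dimension `d ≥ 2` some plaquette contains any given link. [folklore] -/
theorem card_plaquettesTouching_singleton_pos (hd : 2 ≤ d) (e : ZdEdge d) : 0 < (plaquettesTouching {e}).card := by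
  rw [card_plaquettesTouching_singleton]; omega

/-- In dimension `d = 1` no plaquette contains a link: `plaquettesTouching {e} = ∅`. [folklore] -/
theorem plaquettesTouching_singleton_eq_empty_of_d_eq_one (e : ZdEdge 1) : plaquettesTouching {e} = ∅ := by
  rw [← Finset.card_eq_zero, card_plaquettesTouching_singleton]

end Count

/-! ### The one-link law at the unit background is the Gibbs tilt of Haar measure by the Wilson energy -/

section OneLink

variable {G : Type} [Group G]

/-- In the unit configuration every staple is the identity. [folklore] -/
theorem staple_one [DecidableEq (ZdEdge d)] (p : ZdPlaquette d) (x : ZdEdge d) :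
    staple p x (1 : LGConfig d G) = 1 := by
  unfold staple; simp

variable {N : ℕ} (ρ : G →* Matrix (Fin N) (Fin N) ℂ)

/-- **The one-link Wilson action at the unit background**: `S_{e}(1^{e ← g}) = #{p ∋ e}·(N − Re tr ρ(g))`
(`= 2(d−1)(N − Re tr ρ(g))` by `card_plaquettesTouching_singleton`), for unitary `ρ`. [folklore] -/
theorem wilsonBoundaryAction_singleton_update_one [DecidableEq (ZdEdge d)]
    (hρu : ∀ g, ρ g ∈ Matrix.unitaryGroup (Fin N) ℂ) (e : ZdEdge d) (g : G) :
    wilsonBoundaryAction ρ {e} (Function.update (1 : LGConfig d G) e g)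
      = (plaquettesTouching {e}).card * ((N : ℝ) - (ρ g).trace.re) := by
  rw [wilsonBoundaryAction_singleton_update ρ hρu e 1 g]
  simp only [staple_one, map_one, mul_one]
  rw [Finset.sum_const, nsmul_eq_mul]

/-- In dimension `d = 1` the one-link Wilson action vanishes identically (no plaquettes). [folklore] -/
theorem wilsonBoundaryAction_singleton_eq_zero_of_d_eq_one (e : ZdEdge 1) (U : LGConfig 1 G) :
    wilsonBoundaryAction ρ {e} U = 0 := by
  unfold wilsonBoundaryAction
  rw [plaquettesTouching_singleton_eq_empty_of_d_eq_one, Finset.sum_empty]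

variable [MeasurableSpace G] [TopologicalSpace G] [IsTopologicalGroup G] [CompactSpace G] [BorelSpace G]
  [SecondCountableTopology G]

/-- **The identification.** The one-link conditional law of the Wilson specification at the unit background is
the Gibbs tilt of Haar measure by the Wilson energy `s_ρ(g) = 1 − N⁻¹ Re tr ρ(g)` at the effective coupling
`κ = #{p ∋ e}·N·β = 2(d−1)Nβ`: `γ^β_{e}(· | 1) = gibbsTilt Haar s_ρ κ`, i.e.
`γ^β_{e}(dg | 1) ∝ exp(−2(d−1)β(N − Re tr ρ(g))) dg`. [folklore] -/
theorem siteLaw_ymSpecification_one_eq_gibbsTilt [NeZero N] (hρ : Continuous ρ)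
    (hρu : ∀ g, ρ g ∈ Matrix.unitaryGroup (Fin N) ℂ) (β : ℝ) (e : ZdEdge d) :
    siteLaw (ymSpecification ρ β) e (1 : LGConfig d G)
      = gibbsTilt (haarProbability G) (wilsonEnergy ρ) ((plaquettesTouching {e}).card * N * β) := by
  classical
  rw [siteLaw_ymSpecification_eq_tilted_haar ρ hρ β e 1, gibbsTilt_def]
  congr 1
  funext g
  rw [wilsonBoundaryAction_singleton_update_one ρ hρu e g]
  have hN : (N : ℝ) ≠ 0 := Nat.cast_ne_zero.2 (NeZero.ne N)
  simp only [wilsonEnergy, normalisedCharacter]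
  field_simp

/-- The effective coupling written out: `γ^β_{e}(· | 1) = gibbsTilt Haar s_ρ (2(d−1)·N·β)`. [folklore] -/
theorem siteLaw_ymSpecification_one_eq_gibbsTilt' [NeZero N] (hρ : Continuous ρ)
    (hρu : ∀ g, ρ g ∈ Matrix.unitaryGroup (Fin N) ℂ) (β : ℝ) (e : ZdEdge d) :
    siteLaw (ymSpecification ρ β) e (1 : LGConfig d G)
      = gibbsTilt (haarProbability G) (wilsonEnergy ρ) (2 * ((d : ℝ) - 1) * N * β) := by
  rw [siteLaw_ymSpecification_one_eq_gibbsTilt ρ hρ hρu β e, card_plaquettesTouching_singleton]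
  have hd : 1 ≤ d := by
    rcases Nat.eq_zero_or_pos d with h0 | h0
    · subst h0; exact e.2.elim0
    · exact h0
  congr 1
  push_cast [Nat.cast_sub hd]
  ring

/-- The one-link law at the unit background does not depend on the link (translation and axis symmetry, here
simply because every link lies on the same number `2(d−1)` of plaquettes). [folklore] -/
theorem siteLaw_ymSpecification_one_eq_of_edge [NeZero N] (hρ : Continuous ρ)
    (hρu : ∀ g, ρ g ∈ Matrix.unitaryGroup (Fin N) ℂ) (β : ℝ) (e e' : ZdEdge d) :
    siteLaw (ymSpecification ρ β) e (1 : LGConfig d G) = siteLaw (ymSpecification ρ β) e' 1 := by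
  rw [siteLaw_ymSpecification_one_eq_gibbsTilt ρ hρ hρu β e, siteLaw_ymSpecification_one_eq_gibbsTilt ρ hρ hρu β e',
    card_plaquettesTouching_singleton, card_plaquettesTouching_singleton]

/-- **Erratum witness, `d = 1`.** In one dimension the one-link conditional law of the Wilson specification is
Haar measure, at every coupling and for every boundary condition. [folklore] -/
theorem siteLaw_ymSpecification_eq_haar_of_d_eq_one (hρ : Continuous ρ) (β : ℝ) (e : ZdEdge 1)
    (ω : LGConfig 1 G) : siteLaw (ymSpecification ρ β) e ω = haarProbability G := by
  classical
  rw [siteLaw_ymSpecification_eq_tilted_haar ρ hρ β e ω]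
  simp only [wilsonBoundaryAction_singleton_eq_zero_of_d_eq_one, mul_zero]
  exact tilted_const _ 0

/-- **Erratum witness, `d = 1`.** In one dimension Dobrushin's condition in the Vasserstein form holds for the
Wilson specification at EVERY coupling, for every weight `r`, with the empty neighbourhood system and the zero
matrix (all row sums `0`): the large-`β` failure below genuinely needs `d ≥ 2`. [folklore] -/
theorem isKRContraction_ymSpecification_of_d_eq_one (hρ : Continuous ρ) (β : ℝ) (r : G → G → ℝ) :
    IsKRContraction (ymSpecification (d := 1) ρ β) r (fun _ => ∅) (fun _ _ => 0) where
  not_mem x := Finset.notMem_empty x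
  nonneg _ _ := le_rfl
  siteLaw_congr x η η' _ := by
    rw [siteLaw_ymSpecification_eq_haar_of_d_eq_one ρ hρ β x η,
      siteLaw_ymSpecification_eq_haar_of_d_eq_one ρ hρ β x η']
  contract x y hy := absurd hy (Finset.notMem_empty y)

/-! ### Concentration of the one-link law at the identity as `β → +∞` -/

/-- **The one-link law concentrates at the identity at weak coupling.** For `d ≥ 2`, `N ≥ 1` and `ρ` a
continuous faithful unitary representation of the compact group `G`: `∫ f dγ^β_{e}(· | 1) → f(1)` as
`β → +∞`, for every continuous `f : G → ℝ` (Laplace concentration of `gibbsTilt Haar s_ρ κ`, `κ = 2(d−1)Nβ → ∞`,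
at the unique minimiser `1` of the Wilson energy; `tendsto_integral_gibbsTilt_wilsonEnergy`). [folklore] -/
theorem tendsto_integral_siteLaw_ymSpecification_one [NeZero N] (hd : 2 ≤ d) (hρ : Continuous ρ)
    (hρu : ∀ g, ρ g ∈ Matrix.unitaryGroup (Fin N) ℂ) (hρinj : Function.Injective ρ) (e : ZdEdge d)
    {f : G → ℝ} (hf : Continuous f) :
    Tendsto (fun β : ℝ => ∫ s, f s ∂(siteLaw (ymSpecification ρ β) e 1)) atTop (𝓝 (f 1)) := by
  haveI : (haarProbability G).IsOpenPosMeasure := inferInstance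
  have hc : (0 : ℝ) < (plaquettesTouching {e}).card * N := by
    have h1 : (0 : ℝ) < (plaquettesTouching {e}).card := Nat.cast_pos.2 (card_plaquettesTouching_singleton_pos hd e)
    have h2 : (0 : ℝ) < N := Nat.cast_pos.2 (Nat.pos_of_ne_zero (NeZero.ne N))
    positivity
  have key := (tendsto_integral_gibbsTilt_wilsonEnergy (haarProbability G) hρ hρu hρinj hf).comp
    (tendsto_id.const_mul_atTop hc)
  simp only [siteLaw_ymSpecification_one_eq_gibbsTilt ρ hρ hρu]
  exact key

/-- Sequence form of `tendsto_integral_siteLaw_ymSpecification_one`: along any `β_k → +∞`. [folklore] -/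
theorem tendsto_integral_siteLaw_ymSpecification_one_seq [NeZero N] (hd : 2 ≤ d) (hρ : Continuous ρ)
    (hρu : ∀ g, ρ g ∈ Matrix.unitaryGroup (Fin N) ℂ) (hρinj : Function.Injective ρ) (e : ZdEdge d)
    {f : G → ℝ} (hf : Continuous f) {βs : ℕ → ℝ} (hβ : Tendsto βs atTop atTop) :
    Tendsto (fun k => ∫ s, f s ∂(siteLaw (ymSpecification ρ (βs k)) e 1)) atTop (𝓝 (f 1)) :=
  (tendsto_integral_siteLaw_ymSpecification_one ρ hd hρ hρu hρinj e hf).comp hβ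

/-- The gauge-displacement functional of §9b converges: for continuous `φ₁, φ₂` and `h ∈ G`,
`(∫ φ₁ dν_β − ∫ φ₁(h s) ν_β(ds)) + (∫ φ₂ dν_β − ∫ φ₂(s h) ν_β(ds)) → (φ₁(1) − φ₁(h)) + (φ₂(1) − φ₂(h))`
as `β → +∞` — the hypothesis `hconc` of `ym_eventually_lt_rowsum`, discharged. [folklore] -/
theorem tendsto_gaugeDisplacement_siteLaw_one [NeZero N] (hd : 2 ≤ d) (hρ : Continuous ρ)
    (hρu : ∀ g, ρ g ∈ Matrix.unitaryGroup (Fin N) ℂ) (hρinj : Function.Injective ρ) (e : ZdEdge d) (h : G)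
    {φ₁ φ₂ : G → ℝ} (hφ₁c : Continuous φ₁) (hφ₂c : Continuous φ₂) :
    Tendsto (fun β : ℝ =>
      ((∫ s, φ₁ s ∂(siteLaw (ymSpecification ρ β) e 1)) - ∫ s, φ₁ (h * s) ∂(siteLaw (ymSpecification ρ β) e 1))
        + ((∫ s, φ₂ s ∂(siteLaw (ymSpecification ρ β) e 1)) - ∫ s, φ₂ (s * h) ∂(siteLaw (ymSpecification ρ β) e 1)))
      atTop (𝓝 ((φ₁ 1 - φ₁ h) + (φ₂ 1 - φ₂ h))) := by
  have T : ∀ {f : G → ℝ}, Continuous f →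
      Tendsto (fun β : ℝ => ∫ s, f s ∂(siteLaw (ymSpecification ρ β) e 1)) atTop (𝓝 (f 1)) :=
    fun hf => tendsto_integral_siteLaw_ymSpecification_one ρ hd hρ hρu hρinj e hf
  have h₁ : Continuous fun s => φ₁ (h * s) := hφ₁c.comp (continuous_const.mul continuous_id)
  have h₂ : Continuous fun s => φ₂ (s * h) := hφ₂c.comp (continuous_id.mul continuous_const)
  have key := ((T hφ₁c).sub (T h₁)).add ((T hφ₂c).sub (T h₂))
  simp only [mul_one, one_mul] at key
  exact key

/-! ### The unconditional no-go -/

/-- **Gauge covariance defeats the one-link Dobrushin condition at weak coupling — unconditionally.** Let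
`d ≥ 2`, `N ≥ 1`, `ρ : G →* M_N(ℂ)` continuous, unitary and faithful, `r ≥ 0` a weight with `r(a,a) = 0`,
`h ∈ G`, and `φ₁, φ₂ : G → ℝ` continuous and `L`-Lipschitz for `r` with
`L·c·max(r(1,h), r(1,h⁻¹)) < (φ₁(1) − φ₁(h)) + (φ₂(1) − φ₂(h))`. Then for all sufficiently large `β`, EVERY
Dobrushin–Vasserstein matrix `C` of `ymSpecification ρ β` for `r` (`IsKRContraction`, any finite neighbourhood
system `nbr`) has row sum `> c` at EVERY link `e` (the threshold in `β` is uniform in `e`: the one-link law at the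
unit background is the same at all links, `siteLaw_ymSpecification_one_eq_of_edge`). This is `ym_eventually_lt_rowsum`
of the lineage module with its concentration hypothesis `hconc` PROVED (`tendsto_gaugeDisplacement_siteLaw_one`).
[folklore] -/
theorem ym_rowsum_eventually_gt [NeZero N] [T2Space G] (hd : 2 ≤ d) (hρ : Continuous ρ)
    (hρu : ∀ g, ρ g ∈ Matrix.unitaryGroup (Fin N) ℂ) (hρinj : Function.Injective ρ)
    {r : G → G → ℝ} (hr0 : ∀ a b, 0 ≤ r a b) (hr_refl : ∀ a, r a a = 0) (h : G)
    {φ₁ φ₂ : G → ℝ} {L : ℝ} (hφ₁c : Continuous φ₁) (hφ₂c : Continuous φ₂) (hL : 0 ≤ L)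
    (hφ₁L : ∀ a b, |φ₁ a - φ₁ b| ≤ L * r a b) (hφ₂L : ∀ a b, |φ₂ a - φ₂ b| ≤ L * r a b) {c : ℝ}
    (hc : L * (c * max (r 1 h) (r 1 h⁻¹)) < (φ₁ 1 - φ₁ h) + (φ₂ 1 - φ₂ h)) :
    ∀ᶠ β : ℝ in atTop, ∀ (e : ZdEdge d) (nbr : ZdEdge d → Finset (ZdEdge d)) (C : ZdEdge d → ZdEdge d → ℝ),
      IsKRContraction (ymSpecification ρ β) r nbr C → c < ∑ y ∈ nbr e, C e y := by
  -- a reference link (the threshold in `β` obtained there serves every link)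
  obtain ⟨e₀⟩ : Nonempty (ZdEdge d) := ⟨(0, ⟨0, by omega⟩)⟩
  filter_upwards [(tendsto_gaugeDisplacement_siteLaw_one ρ hd hρ hρu hρinj e₀ h hφ₁c hφ₂c).eventually_const_lt hc]
    with β hβ e nbr C hC
  rw [siteLaw_ymSpecification_one_eq_of_edge ρ hρ hρu β e₀ e] at hβ
  by_contra hle
  exact (lt_irrefl _) (hβ.trans_le (ym_two_tests_le_rowsum ρ hρ β hC hr0 hr_refl e h hφ₁c.measurable
    hφ₂c.measurable (exists_abs_le_of_continuous hφ₁c) (exists_abs_le_of_continuous hφ₂c) hL hφ₁L hφ₂L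
    (not_lt.1 hle)))

/-- Sequence form of `ym_rowsum_eventually_gt`: along any `β_k → +∞`, uniformly in the link. [folklore] -/
theorem ym_rowsum_eventually_gt_seq [NeZero N] [T2Space G] (hd : 2 ≤ d) (hρ : Continuous ρ)
    (hρu : ∀ g, ρ g ∈ Matrix.unitaryGroup (Fin N) ℂ) (hρinj : Function.Injective ρ)
    {r : G → G → ℝ} (hr0 : ∀ a b, 0 ≤ r a b) (hr_refl : ∀ a, r a a = 0) (h : G)
    {φ₁ φ₂ : G → ℝ} {L : ℝ} (hφ₁c : Continuous φ₁) (hφ₂c : Continuous φ₂) (hL : 0 ≤ L)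
    (hφ₁L : ∀ a b, |φ₁ a - φ₁ b| ≤ L * r a b) (hφ₂L : ∀ a b, |φ₂ a - φ₂ b| ≤ L * r a b)
    {βs : ℕ → ℝ} (hβ : Tendsto βs atTop atTop) {c : ℝ}
    (hc : L * (c * max (r 1 h) (r 1 h⁻¹)) < (φ₁ 1 - φ₁ h) + (φ₂ 1 - φ₂ h)) :
    ∀ᶠ k in atTop, ∀ (e : ZdEdge d) (nbr : ZdEdge d → Finset (ZdEdge d)) (C : ZdEdge d → ZdEdge d → ℝ),
      IsKRContraction (ymSpecification ρ (βs k)) r nbr C → c < ∑ y ∈ nbr e, C e y :=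
  hβ.eventually (ym_rowsum_eventually_gt ρ hd hρ hρu hρinj hr0 hr_refl h hφ₁c hφ₂c hL hφ₁L hφ₂L hc)

/-- **`ym_eventually_lt_rowsum` discharged, literally.** The lineage module's conditional statement at a fixed
link `e` along `β_k → +∞`, with its hypothesis `hconc` supplied by `tendsto_gaugeDisplacement_siteLaw_one`
(`ℓ = (φ₁(1) − φ₁(h)) + (φ₂(1) − φ₂(h))`); the proof term IS `ym_eventually_lt_rowsum` applied to the proved
concentration. [folklore] -/
theorem ym_eventually_lt_rowsum_of_continuous [NeZero N] [T2Space G] (hd : 2 ≤ d) (hρ : Continuous ρ)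
    (hρu : ∀ g, ρ g ∈ Matrix.unitaryGroup (Fin N) ℂ) (hρinj : Function.Injective ρ)
    {r : G → G → ℝ} (hr0 : ∀ a b, 0 ≤ r a b) (hr_refl : ∀ a, r a a = 0) (e : ZdEdge d) (h : G)
    {φ₁ φ₂ : G → ℝ} {L : ℝ} (hφ₁c : Continuous φ₁) (hφ₂c : Continuous φ₂) (hL : 0 ≤ L)
    (hφ₁L : ∀ a b, |φ₁ a - φ₁ b| ≤ L * r a b) (hφ₂L : ∀ a b, |φ₂ a - φ₂ b| ≤ L * r a b)
    {βs : ℕ → ℝ} (hβ : Tendsto βs atTop atTop) {c : ℝ}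
    (hc : L * (c * max (r 1 h) (r 1 h⁻¹)) < (φ₁ 1 - φ₁ h) + (φ₂ 1 - φ₂ h)) :
    ∀ᶠ k in atTop, ∀ (nbr : ZdEdge d → Finset (ZdEdge d)) (C : ZdEdge d → ZdEdge d → ℝ),
      IsKRContraction (ymSpecification ρ (βs k)) r nbr C → c < ∑ y ∈ nbr e, C e y :=
  ym_eventually_lt_rowsum ρ hρ hr0 hr_refl e h hφ₁c.measurable hφ₂c.measurable (exists_abs_le_of_continuous hφ₁c)
    (exists_abs_le_of_continuous hφ₂c) hL hφ₁L hφ₂L βs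
    ((tendsto_gaugeDisplacement_siteLaw_one ρ hd hρ hρu hρinj e h hφ₁c hφ₂c).comp hβ) hc

/-- **Total-variation weight: every `c < 2` is eventually exceeded.** For the weight `r(a,b) = 1_{a ≠ b}` (the
Kantorovich–Rubinstein distance dual to it is total variation — Dobrushin's original setting) and any `h ≠ 1`:
eventually in `β` every Dobrushin matrix of `ymSpecification ρ β` has row sum `> c` at `e`, for every `c < 2`. In
particular the uniqueness condition "row sums `≤ c < 1`" fails at all large `β`. Test functions: an Urysohn
function equal to `1` at `1` and `0` at `h` (compact Hausdorff groups are normal). [folklore] -/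
theorem ym_rowsum_eventually_gt_tv [NeZero N] [T2Space G] (hd : 2 ≤ d) (hρ : Continuous ρ)
    (hρu : ∀ g, ρ g ∈ Matrix.unitaryGroup (Fin N) ℂ) (hρinj : Function.Injective ρ)
    {r : G → G → ℝ} (hr_ne : ∀ a b, a ≠ b → r a b = 1) (hr_refl : ∀ a, r a a = 0)
    {h : G} (hh : h ≠ 1) {c : ℝ} (hc : c < 2) :
    ∀ᶠ β : ℝ in atTop, ∀ (e : ZdEdge d) (nbr : ZdEdge d → Finset (ZdEdge d)) (C : ZdEdge d → ZdEdge d → ℝ),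
      IsKRContraction (ymSpecification ρ β) r nbr C → c < ∑ y ∈ nbr e, C e y := by
  obtain ⟨f, hf0, hf1, hf01⟩ := exists_continuous_zero_one_of_isClosed (isClosed_singleton (x := h))
    (isClosed_singleton (x := (1 : G))) (Set.disjoint_singleton.2 hh)
  have hr0 : ∀ a b, 0 ≤ r a b := fun a b => by
    by_cases hab : a = b
    · rw [hab, hr_refl]
    · rw [hr_ne a b hab]; exact zero_le_one
  have hLip : ∀ a b, |f a - f b| ≤ 1 * r a b := fun a b => by
    by_cases hab : a = b
    · subst hab; simp [hr_refl]
    · rw [hr_ne a b hab, one_mul, abs_le]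
      have ha := hf01 a
      have hb := hf01 b
      constructor <;> linarith [ha.1, ha.2, hb.1, hb.2]
  have hfh : f h = 0 := by simpa using hf0 (Set.mem_singleton h)
  have hf1' : f 1 = 1 := by simpa using hf1 (Set.mem_singleton (1 : G))
  refine ym_rowsum_eventually_gt ρ hd hρ hρu hρinj hr0 hr_refl h f.continuous f.continuous zero_le_one hLip
    hLip ?_
  rw [hfh, hf1', hr_ne 1 h hh.symm, hr_ne 1 h⁻¹ (fun h1 => hh (inv_eq_one.1 h1.symm)), max_self]
  linarith

/-- **Continuous pseudo-metric weights.** For a continuous weight `r ≥ 0` that is symmetric, satisfies the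
triangle inequality and `r(a,a) = 0` (e.g. any continuous left-invariant metric on `G`), and `h ∈ G`: every `c`
with `c·max(r(1,h), r(1,h⁻¹)) < 2 r(1,h)` is eventually exceeded by the row sum at `e` of every Dobrushin matrix
of `ymSpecification ρ β` for `r` (test functions `φ₁ = φ₂ = r(·, h)`, `1`-Lipschitz by the triangle
inequality). [folklore] -/
theorem ym_rowsum_eventually_gt_of_continuous [NeZero N] [T2Space G] (hd : 2 ≤ d) (hρ : Continuous ρ)
    (hρu : ∀ g, ρ g ∈ Matrix.unitaryGroup (Fin N) ℂ) (hρinj : Function.Injective ρ)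
    {r : G → G → ℝ} (hr_symm : ∀ a b, r a b = r b a) (hr_tri : ∀ a b c, r a c ≤ r a b + r b c)
    (hr0 : ∀ a b, 0 ≤ r a b) (hr_refl : ∀ a, r a a = 0) (hrc : ∀ b, Continuous fun a => r a b)
    (h : G) {c : ℝ} (hc : c * max (r 1 h) (r 1 h⁻¹) < 2 * r 1 h) :
    ∀ᶠ β : ℝ in atTop, ∀ (e : ZdEdge d) (nbr : ZdEdge d → Finset (ZdEdge d)) (C : ZdEdge d → ZdEdge d → ℝ),
      IsKRContraction (ymSpecification ρ β) r nbr C → c < ∑ y ∈ nbr e, C e y := by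
  refine ym_rowsum_eventually_gt ρ hd hρ hρu hρinj hr0 hr_refl h (hrc h) (hrc h) zero_le_one
    (fun a b => abs_weight_sub_weight_le hr_symm hr_tri a b h)
    (fun a b => abs_weight_sub_weight_le hr_symm hr_tri a b h) ?_
  rw [hr_refl, sub_zero, one_mul]
  linarith

/-- **Left-invariant continuous pseudo-metric weights: every `c < 2` is eventually exceeded** — as soon as some
`h` has `r(1,h) > 0` (left invariance and symmetry give `r(1,h⁻¹) = r(1,h)`). This covers the bi-invariant
Riemannian distance on `SU(N)` used by Shen–Zhu–Zhu (CMP 400 (2023) §4.1) and every continuous bi-invariant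
metric. [folklore] -/
theorem ym_rowsum_eventually_gt_of_leftInvariant [NeZero N] [T2Space G] (hd : 2 ≤ d) (hρ : Continuous ρ)
    (hρu : ∀ g, ρ g ∈ Matrix.unitaryGroup (Fin N) ℂ) (hρinj : Function.Injective ρ)
    {r : G → G → ℝ} (hr_symm : ∀ a b, r a b = r b a) (hr_tri : ∀ a b c, r a c ≤ r a b + r b c)
    (hr0 : ∀ a b, 0 ≤ r a b) (hr_refl : ∀ a, r a a = 0) (hr_left : ∀ g a b, r (g * a) (g * b) = r a b)
    (hrc : ∀ b, Continuous fun a => r a b) {h : G} (hh : 0 < r 1 h) {c : ℝ} (hc : c < 2) :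
    ∀ᶠ β : ℝ in atTop, ∀ (e : ZdEdge d) (nbr : ZdEdge d → Finset (ZdEdge d)) (C : ZdEdge d → ZdEdge d → ℝ),
      IsKRContraction (ymSpecification ρ β) r nbr C → c < ∑ y ∈ nbr e, C e y := by
  have hinv : r 1 h⁻¹ = r 1 h := by
    have := hr_left h 1 h⁻¹
    rw [mul_one, mul_inv_cancel] at this
    rw [← this, hr_symm]
  refine ym_rowsum_eventually_gt_of_continuous ρ hd hρ hρu hρinj hr_symm hr_tri hr0 hr_refl hrc h ?_
  rw [hinv, max_self]
  nlinarith

end OneLink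

/-! ### The Shen–Zhu–Zhu setting: `SU(N)`, fundamental representation, 't Hooft scaling -/

section SUN

/-- **No large-`β` analogue of the hypothesis of `shen_zhu_zhu_of_dobrushinCondition` for the total-variation
weight.** In the tree's Shen–Zhu–Zhu setting — gauge group `SU(N)` (`N ≥ 1`), fundamental representation,
't Hooft-scaled coupling `N β`, `d ≥ 2` — for the weight `r(a,b) = 1_{a ≠ b}` and any `h ≠ 1` in `SU(N)`:
eventually in `β`, every Dobrushin–Vasserstein matrix of `ymSpecification (fundamentalRep (Fin N)) (N β)` for `r`,
for EVERY finite neighbourhood system, has row sum `> c` at every given link, for every `c < 2`; whereas the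
strong-coupling pipeline needs row sums `≤ c < 1` (there: `|β| < 1/(16(d−1))`, SZZ Assumption 1.1). [folklore] -/
theorem sun_rowsum_eventually_gt_tv {N : ℕ} [NeZero N] (hd : 2 ≤ d)
    {r : Matrix.specialUnitaryGroup (Fin N) ℂ → Matrix.specialUnitaryGroup (Fin N) ℂ → ℝ}
    (hr_ne : ∀ a b, a ≠ b → r a b = 1) (hr_refl : ∀ a, r a a = 0)
    {h : Matrix.specialUnitaryGroup (Fin N) ℂ} (hh : h ≠ 1) {c : ℝ} (hc : c < 2) :
    ∀ᶠ β : ℝ in atTop, ∀ (e : ZdEdge d) (nbr : ZdEdge d → Finset (ZdEdge d)) (C : ZdEdge d → ZdEdge d → ℝ),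
      IsKRContraction (ymSpecification (fundamentalRep (Fin N)) (N * β)) r nbr C → c < ∑ y ∈ nbr e, C e y := by
  haveI : SecondCountableTopology (Matrix (Fin N) (Fin N) ℂ) :=
    inferInstanceAs (SecondCountableTopology (Fin N → Fin N → ℂ))
  haveI : SecondCountableTopology (Matrix.specialUnitaryGroup (Fin N) ℂ) :=
    Topology.IsEmbedding.subtypeVal.secondCountableTopology
  have hN : (0 : ℝ) < N := Nat.cast_pos.2 (Nat.pos_of_ne_zero (NeZero.ne N))
  have hev := ym_rowsum_eventually_gt_tv (fundamentalRep (Fin N)) hd (continuous_fundamentalRep (Fin N))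
    fundamentalRep_mem_unitaryGroup (fundamentalRep_injective (Fin N)) hr_ne hr_refl hh hc
  exact (tendsto_id.const_mul_atTop hN).eventually hev

end SUN

end Literature.MathematicalPhysics.QuantumFieldTheory.Balaban1983to89.Sufficient
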